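/-
Copyright (c) 2026. All rights reserved.
Released under Apache 2.0 license as described in the file LICENSE.
-/
import Mathlib
import HarnessLib
import Literature.MathematicalPhysics.QuantumLattice.AbelianFieldTensor
import Literature.MathematicalPhysics.QuantumLattice.AbelianMagneticFlux
import Literature.MathematicalPhysics.QuantumFieldTheory.U1WardIdentity
import Summits.Ventures.LatticeQCDFlow.Scaling.FluxInsertionHeightLaw
import Summits.Ventures.LatticeQCDFlow.Scaling.FluxInsertionLineHeightValue
import Summits.Ventures.LatticeQCDFlow.Scaling.FluxInsertionLineHeightValueFour
import Summits.Ventures.LatticeQCDFlow.Scaling.FluxInsertionMountainPassThree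

/-!
# The LINE flux-insertion kernel: the sharp fixed-volume rate at EVERY volume `L ≥ 3`
# (lean-1 GEN-7, own work)

HONEST FRAMING: exact (Metropolis-corrected) sampling algorithms for lattice gauge theory;
figures of merit are autocorrelation/cost numbers at stated couplings and volumes; no
continuum-physics claim.

Venture `LatticeQCDFlow` (cell pub-lqcd), topic `Scaling`, FANOUT row 30 (lean-1).  NEW WORK of the
cell; nothing here is cited as a fact; no `def`.  `d = 2`, compact `U(1)`, torus `(ℤ/L)²`; gen-19's
two-sided Metropolis LINE-insertion kernel `K_line = insertionMH (sliceTwist L) e^{−βS}` (item 99),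
its essential min–max height `H_line(L) = insHeight₂ (sliceTwist L) 0 0 1` (item 106b) and
`E*_line(L) = L(1 − cos(π/L)) + (L² − L)(1 − cos(π/(L² − L)))`.

`Scaling/FluxInsertionLineHeightValue` (lean-1 GEN-6, `L ≥ 5`) and `…Four` (GEN-7, `L ≥ 4`)
proved `H_line(L) = E*_line(L)` and the fixed-volume Laplace law with that exponent; the one
remaining volume with a proper wrapping line, `L = 3` (`N = 3` touched plaquettes, contact `π/3`,
`M = 6`), is covered by the weighted-tangent mountain pass of `Scaling/FluxInsertionMountainPassThree`.
This file records:
* `lineThreeSharpValue_le_max_wilsonAction`: at `L = 3`, for EVERY `U` with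
  `Q((sliceTwist 3)⁻¹ U) ≠ Q(U)`, `max(S(U), S((sliceTwist 3)⁻¹ U)) ≥ 3(1 − cos(π/3)) + 6(1 − cos(π/6))`;
* `lineHeight_eq_sharp_three`: `H_line(3) = 3(1 − cos(π/3)) + 6(1 − cos(π/6))` (`= 15/2 − 3√3`,
  `lineHeight_three_closedForm`);
* **`lineHeight_eq_sharp_of_three_le`**: `H_line(L) = E*_line(L)` for EVERY `L ≥ 3`;
* **`u1_lineInsertion_fixedVolume_rate_of_three_le`**: for every `L ≥ 3` and `ε > 0`, eventually
  in `β`, `e^{−β(E*_line + ε)} ≤ (μ_β ⊗ K_line){Q ≠ Q'} ≤ e^{−β(E*_line − ε)}` — the fixed-volume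
  sharp rate of the line kernel EXISTS and EQUALS `E*_line(L)` at every volume at which the
  wrapping line is a proper subset of the torus (conjecture C9″c of the cell's THEORY-2.md §4 said
  `L ≥ 4`).  `L = 2` (two plaquettes on the line, two off it) is not treated.
No `def`, no `sorry`, standard axioms only.
-/

noncomputable section

open MeasureTheory ProbabilityTheory Filter Topology Real Set
open scoped ENNReal
open Literature.MathematicalPhysics.QuantumFieldTheory Literature.MathematicalPhysics.QuantumLattice
open Summit.Ventures.LatticeQCDFlow.Exactness

namespace Summit.Ventures.LatticeQCDFlow.Theory2.Lattice.Flux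

/-! ## §1 The line at `L = 3` -/

section LineThree

/-- **THE MOUNTAIN-PASS INEQUALITY FOR THE LINE AT `L = 3`**: for EVERY configuration `U` whose
charge is changed by the inverse slice twist, `max(S(U), S((sliceTwist 3)⁻¹ U)) ≥
3(1 − cos(π/3)) + 6(1 − cos(π/6))`. [folklore] -/
theorem lineThreeSharpValue_le_max_wilsonAction (U : GaugeConfig 2 3 Circle)
    (hne : topCharge (0 : Site 2 3) 0 1 ((sliceTwist 3)⁻¹ * U) ≠ topCharge (0 : Site 2 3) 0 1 U) :
    3 * (1 - Real.cos (π / 3)) + 6 * (1 - Real.cos (π / 6)) ≤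
      max (wilsonAction u1Rep U) (wilsonAction u1Rep ((sliceTwist 3)⁻¹ * U)) := by
  have hN : (lineSites 3).card = 3 := card_lineSites
  have hM : (lineSites 3)ᶜ.card = 6 := by
    have h : (((lineSites 3)ᶜ.card : ℕ) : ℝ) = (3 : ℕ) ^ 2 - (3 : ℕ) := card_compl_lineSites
    norm_num at h
    exact_mod_cast h
  have hW : ∀ x : Site 2 3, plaquetteHolonomy (sliceTwist 3)⁻¹ x 0 1 =
      Circle.exp (if x ∈ lineSites 3 then 2 * π / 3 else 0) := fun x => by
    rw [plaquetteHolonomy_sliceTwist_inv_ite]; norm_num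
  exact threeSharpValue_le_max_wilsonAction_of_exp (sliceTwist 3)⁻¹ U (lineSites 3) hW hN hM hne

/-- **THE FLOOR FOR THE LINE AT `L = 3`**: `E*_line(3) ≤ H_line(3)`. [folklore] -/
theorem lineHeight_ge_sharp_three :
    (3 : ℝ) * (1 - Real.cos (π / 3)) + ((3 : ℝ) ^ 2 - 3) * (1 - Real.cos (π / ((3 : ℝ) ^ 2 - 3))) ≤
      (insHeight₂ (sliceTwist 3) (0 : Site 2 3) 0 1).toReal := by
  refine (ENNReal.ofReal_le_iff_le_toReal (lineHeight_ne_top_two (L := 3) (by norm_num))).mp ?_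
  rw [← insHeight₂_inv]
  refine le_insHeight₂_of_forall _ _ _ _ fun U hU => ?_
  have h := lineThreeSharpValue_le_max_wilsonAction U hU
  norm_num at h ⊢
  exact h

/-- **THE VALUE OF THE LINE HEIGHT AT `L = 3`**: `H_line(3) = 3(1 − cos(π/3)) + 6(1 − cos(π/6))`
(in the uniform form `L(1 − cos(π/L)) + (L² − L)(1 − cos(π/(L² − L)))` at `L = 3`). [folklore] -/
theorem lineHeight_eq_sharp_three :
    (insHeight₂ (sliceTwist 3) (0 : Site 2 3) 0 1).toReal =
      ((3 : ℕ) : ℝ) * (1 - Real.cos (π / (3 : ℕ))) +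
        (((3 : ℕ) : ℝ) ^ 2 - (3 : ℕ)) * (1 - Real.cos (π / (((3 : ℕ) : ℝ) ^ 2 - (3 : ℕ)))) :=
  le_antisymm (ENNReal.toReal_le_of_le_ofReal (lineSharpValue_nonneg_two (L := 3) (by norm_num))
    (lineHeight_le_sharp_ennreal_two (L := 3) (by norm_num)))
    (by have h := lineHeight_ge_sharp_three; norm_num at h ⊢; exact h)

/-- **Closed form at `L = 3`**: `H_line(3) = 15/2 − 3√3` (`≈ 2.3038`). [folklore] -/
theorem lineHeight_three_closedForm :
    (insHeight₂ (sliceTwist 3) (0 : Site 2 3) 0 1).toReal = 15 / 2 - 3 * √3 := by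
  rw [lineHeight_eq_sharp_three]
  have e : ((3 : ℕ) : ℝ) ^ 2 - (3 : ℕ) = 6 := by norm_num
  rw [e, show ((3 : ℕ) : ℝ) = 3 by norm_num, Real.cos_pi_div_three, Real.cos_pi_div_six]
  ring

end LineThree

/-! ## §2 Every volume `L ≥ 3` -/

section EveryVolume

variable {L : ℕ} [NeZero L]

/-- **THE VALUE OF THE LINE HEIGHT AT EVERY VOLUME `L ≥ 3`**:
`H_line(L) = L(1 − cos(π/L)) + (L² − L)(1 − cos(π/(L² − L)))`. [folklore] -/
theorem lineHeight_eq_sharp_of_three_le (hL : 3 ≤ L) :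
    (insHeight₂ (sliceTwist L) (0 : Site 2 L) 0 1).toReal =
      (L : ℝ) * (1 - Real.cos (π / L)) +
        ((L : ℝ) ^ 2 - L) * (1 - Real.cos (π / ((L : ℝ) ^ 2 - L))) := by
  rcases Nat.lt_or_ge L 4 with h4 | h4
  · obtain rfl : L = 3 := by omega
    exact lineHeight_eq_sharp_three
  · exact lineHeight_eq_sharp_four h4

/-- **The line height is `O(1/L)` for every `L ≥ 3`**: `H_line(L) ≤ π²/L`. [folklore] -/
theorem lineHeight_le_pi_sq_div_of_three_le (hL : 3 ≤ L) :
    (insHeight₂ (sliceTwist L) (0 : Site 2 L) 0 1).toReal ≤ π ^ 2 / L := by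
  rw [lineHeight_eq_sharp_of_three_le hL]
  have hL' : (3 : ℝ) ≤ L := by exact_mod_cast hL
  set m : ℝ := (L : ℝ) ^ 2 - L with hm
  have hmL : (L : ℝ) ≤ m := by rw [hm]; nlinarith
  have hm0 : 0 < m := by linarith
  have h1 : (L : ℝ) * (1 - Real.cos (π / L)) ≤ π ^ 2 / (2 * L) := by
    have hc : 1 - (π / L) ^ 2 / 2 ≤ Real.cos (π / L) := Real.one_sub_sq_div_two_le_cos
    have e : (L : ℝ) * ((π / L) ^ 2 / 2) = π ^ 2 / (2 * L) := by field_simp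
    calc (L : ℝ) * (1 - Real.cos (π / L)) ≤ L * ((π / L) ^ 2 / 2) :=
          mul_le_mul_of_nonneg_left (by linarith) (by linarith)
      _ = π ^ 2 / (2 * L) := e
  have h2 : m * (1 - Real.cos (π / m)) ≤ π ^ 2 / (2 * L) := by
    have hc : 1 - (π / m) ^ 2 / 2 ≤ Real.cos (π / m) := Real.one_sub_sq_div_two_le_cos
    have e : m * ((π / m) ^ 2 / 2) = π ^ 2 / (2 * m) := by field_simp
    calc m * (1 - Real.cos (π / m)) ≤ m * ((π / m) ^ 2 / 2) :=
          mul_le_mul_of_nonneg_left (by linarith) (by linarith)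
      _ = π ^ 2 / (2 * m) := e
      _ ≤ π ^ 2 / (2 * L) := div_le_div_of_nonneg_left (by positivity) (by positivity) (by linarith)
  have e3 : π ^ 2 / (2 * (L : ℝ)) + π ^ 2 / (2 * L) = π ^ 2 / L := by field_simp; ring
  linarith [h1, h2, e3]

/-- **THE FIXED-VOLUME SHARP RATE OF THE LINE KERNEL AT EVERY VOLUME `L ≥ 3`** (every parity): for
every `ε > 0`, eventually in `β`, `e^{−β(E*_line + ε)} ≤ (μ_β ⊗ K_line){Q ≠ Q'} ≤ e^{−β(E*_line − ε)}`
with `E*_line = L(1 − cos(π/L)) + (L² − L)(1 − cos(π/(L² − L)))`. [folklore] -/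
theorem u1_lineInsertion_fixedVolume_rate_of_three_le (hL : 3 ≤ L) {ε : ℝ} (hε : 0 < ε) :
    ∀ᶠ β : ℝ in atTop,
      Real.exp (-(β * ((L : ℝ) * (1 - Real.cos (π / L)) +
          ((L : ℝ) ^ 2 - L) * (1 - Real.cos (π / ((L : ℝ) ^ 2 - L))) + ε))) ≤
        ((wilsonMeasure (d := 2) (L := L) u1Rep β) ⊗ₘ lineInsertionMH (L := L) β).real
          {q | topCharge (0 : Site 2 L) 0 1 q.1 ≠ topCharge (0 : Site 2 L) 0 1 q.2} ∧
      ((wilsonMeasure (d := 2) (L := L) u1Rep β) ⊗ₘ lineInsertionMH (L := L) β).real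
          {q | topCharge (0 : Site 2 L) 0 1 q.1 ≠ topCharge (0 : Site 2 L) 0 1 q.2} ≤
        Real.exp (-(β * ((L : ℝ) * (1 - Real.cos (π / L)) +
          ((L : ℝ) ^ 2 - L) * (1 - Real.cos (π / ((L : ℝ) ^ 2 - L))) - ε))) := by
  simp only [lineInsertion_real_eq, ← lineHeight_eq_sharp_of_three_le hL]
  exact insertion_height_law (sliceTwist L) (0 : Site 2 L) 0 1 (lineHeight_ne_top_two (by omega)) hε

end EveryVolume

end Summit.Ventures.LatticeQCDFlow.Theory2.Lattice.Flux

end
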